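import Summits.ResolutionOfSingularities.KangarooAtlas.MizutaniExtremalProfile
import HarnessLib

/-!
# First-order profile of a tower: the derivations `sigD_{e_l}` and `dim Θ_1(v) = 1 + r` (Mizutani 1973, proof of Thm. 2.8)

Cell `pub-rosobs`, Mizutani enclosure (seat mizutani-encloser-2, gen 6). AI-written; AI review is weaker than expert
review; NOT a resolution-of-singularities theorem (summit relevance C).

Mizutani's proof of Thm. 2.8 (p. 90–92) uses, besides `dim θ_1(f) ≥ 2p − 1` (the profile bound, tree
`profile_theorem` / `MizutaniExtremalProfile.lean`), the first-order count «`dim_k Diff_1(k)·f = r + 1` if `[k^p(c(f)) : k^p] = p^r`»: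
the operators of order `≤ 1` are `k ⊕ Der(k/k^p)`, and the derivations of `k/k^p` applied to a vector `f` with `f_0 = 1` span as many
dimensions as the coefficient field `k^p(f_1, …, f_n)` has `p`-independent generators.  This file proves it at tower level
(`IsRootTower L K q x a`, the anti-Hasse–Schmidt operators `sigD_T` of `MizutaniRootTowerBridge.lean`):

* `IsRootTower.sigD_mul` (Leibniz rule for `sigD_T`, `T` in the box), `sigD_single_mul` (order one: a DERIVATION), `sigD_single_gen`
  (`sigD_{e_l}(a_j) = −δ_{lj}`), `sigD_algebraMap` (kills `L`), `IsRootTower.der` (the `Derivation L K K` `−sigD_{e_l}`);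
* `eq_zero_or_exists_single_of_degree_le_one`, `thetaSpan_one_eq` (`Θ_1(v) = span{v, (sigD_{e_l} v)_l}`);
* **`IsRootTower.finrank_thetaSpan_one`** — for `v` with `v_{i₀} = 1` and an ADAPTED `p`-basis (`L(v_i : i) = L(a_j : j ∈ Y)` for a set `Y` of
  generator indices): `dim_K Θ_1(v) = #Y + 1`;
* **`IsRootTower.finrank_thetaSpan_add_le_card`** — the UPPER bound complementing `two_mul_pow_le_finrank_thetaSpan_succ`: if `d` `K`-linearly
  independent columns `W_l` satisfy `Σ_i v_i ⊗ W_l i ∈ J^q`, then `dim_K Θ_{q−1}(v) + d ≤ #ι` (Mizutani: `θ_1(f) ⊂` the forms through the point).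

Used by `MizutaniExtremalTwo.lean` (Thm. 2.8 second part for `p = 2`).

## References

* H. Mizutani, *Hironaka's additive group schemes*, Nagoya Math. J. 52 (1973) 85–95, proof of Thm. 2.8, Step (I) (p. 91: «dim Diff_1(k) f = r + 1 if
  [K : k^p] = p^r»). [Mizutani1973HironakaGroupSchemes]
* A. Grothendieck, EGA IV₄, Thm. 16.11.2 (Taylor morphism of a `p`-basis). [EGAIV4]
-/

noncomputable section

open MvPolynomial TensorProduct Literature.AlgebraicGeometry.Resolution
  Literature.AlgebraicGeometry.Resolution.HironakaScheme

namespace Summit.ResolutionOfSingularities.KangarooAtlas.Mizutani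

universe u

section TowerDerivation

variable {L K : Type*} [Field L] [Field K] [Algebra L K] {s p e : ℕ} [hp : Fact p.Prime] [CharP K p]
  {x : Fin s → L} {a : Fin s → K}

/-- **Leibniz rule** for the anti-Hasse–Schmidt operators: `sigD_T(yz) = Σ_{T₁+T₂=T} sigD_{T₁} y · sigD_{T₂} z` for `T` in the box
(`sig` is multiplicative). [cite: EGAIV4, Thm. 16.11.2 (16.11.2.2)] -/
theorem IsRootTower.sigD_mul (h : IsRootTower L K (p ^ e) x a) {T : Fin s →₀ ℕ} (hT : InBox (p ^ e) T) (y z : K) :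
    h.sigD T (y * z) = ∑ w ∈ Finset.HasAntidiagonal.antidiagonal T, h.sigD w.1 y * h.sigD w.2 z := by
  simp only [h.sigD_apply]
  rw [map_mul, truncQ_mul, coeff_trunc, if_pos hT, coeff_mul]

/-- **Order one: `sigD_{e_l}` is a derivation** — `sigD_{e_l}(yz) = sigD_{e_l}(y) z + y sigD_{e_l}(z)`. [cite: EGAIV4, Thm. 16.11.2] -/
theorem IsRootTower.sigD_single_mul (h : IsRootTower L K (p ^ e) x a) (he : 1 ≤ e) (l : Fin s) (y z : K) :
    h.sigD (Finsupp.single l 1) (y * z) = h.sigD (Finsupp.single l 1) y * z + y * h.sigD (Finsupp.single l 1) z := by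
  rw [h.sigD_mul (inBox_single_one he l), Finsupp.antidiagonal_single, Finset.sum_map, Finset.Nat.sum_antidiagonal_succ,
    Finset.Nat.antidiagonal_zero, Finset.sum_singleton]
  simp only [Function.Embedding.coe_prodMap, Function.Embedding.coeFn_mk, Prod.map_apply, Finsupp.single_zero, zero_add]
  rw [h.sigD_zero, LinearMap.id_apply, LinearMap.id_apply]
  ring

/-- `sigD_{e_l}(a_j) = −δ_{lj}` (`sig a_j = a_j − u_j`). [cite: EGAIV4, Thm. 16.11.2] -/
theorem IsRootTower.sigD_single_gen (h : IsRootTower L K (p ^ e) x a) (he : 1 ≤ e) (l j : Fin s) :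
    h.sigD (Finsupp.single l 1) (a j) = if j = l then -1 else 0 := by
  classical
  rw [h.sigD_apply, h.sig_gen, truncQ_mk]
  have hbox : ∀ M ∈ (C (a j) - X j : MvPolynomial (Fin s) K).support, InBox (p ^ e) M := by
    intro M hM
    have hM' := support_sub (σ := Fin s) (C (a j)) (X j) hM
    rw [Finset.mem_union] at hM'
    rcases hM' with hM' | hM'
    · rw [mem_support_iff, coeff_C] at hM'
      split_ifs at hM' with h0
      · rw [← h0]; intro i; simp only [Finsupp.coe_zero, Pi.zero_apply]; exact Nat.one_le_pow _ _ hp.out.pos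
      · exact absurd rfl hM'
    · rw [mem_support_iff, coeff_X] at hM'
      split_ifs at hM' with h0
      · rw [← h0]; exact inBox_single_one he j
      · exact absurd rfl hM'
  rw [trunc_eq_self hbox, coeff_sub, coeff_C, coeff_X, if_neg (Finsupp.single_ne_zero.mpr one_ne_zero).symm, zero_sub]
  by_cases hjl : j = l
  · subst hjl; simp
  · rw [if_neg, if_neg hjl, neg_zero]
    intro h'
    exact hjl (Finsupp.single_left_injective one_ne_zero h')

/-- `sigD_T(1) = 0` for `T ≠ 0`. [folklore] -/
theorem IsRootTower.sigD_one (h : IsRootTower L K (p ^ e) x a) {T : Fin s →₀ ℕ} (hT : T ≠ 0) : h.sigD T 1 = 0 := by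
  classical
  rw [h.sigD_apply, map_one, ← (Ideal.Quotient.mk _).map_one, truncQ_mk, ← C_1,
    trunc_eq_self (fun M hM => by
      rw [mem_support_iff, coeff_C] at hM
      split_ifs at hM with h0
      · rw [← h0]; intro i; simp only [Finsupp.coe_zero, Pi.zero_apply]; exact Nat.one_le_pow _ _ hp.out.pos
      · exact absurd rfl hM), coeff_C, if_neg (Ne.symm hT)]

/-- `sigD_T` kills `L` for `T ≠ 0`. [folklore] -/
theorem IsRootTower.sigD_algebraMap (h : IsRootTower L K (p ^ e) x a) {T : Fin s →₀ ℕ} (hT : T ≠ 0) (c : L) :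
    h.sigD T (algebraMap L K c) = 0 := by
  rw [Algebra.algebraMap_eq_smul_one, LinearMap.map_smul, h.sigD_one hT, smul_zero]

/-- **The derivation `der_l = sigD_{e_l}`** of `K` over `L` (as a Mathlib `Derivation`). [cite: EGAIV4, Thm. 16.11.2] -/
noncomputable def IsRootTower.der (h : IsRootTower L K (p ^ e) x a) (he : 1 ≤ e) (l : Fin s) : Derivation L K K where
  toLinearMap := h.sigD (Finsupp.single l 1)
  map_one_eq_zero' := h.sigD_one (Finsupp.single_ne_zero.mpr one_ne_zero)
  leibniz' y z := by
    change h.sigD (Finsupp.single l 1) (y * z) = y • h.sigD (Finsupp.single l 1) z + z • h.sigD (Finsupp.single l 1) y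
    rw [h.sigD_single_mul he, smul_eq_mul, smul_eq_mul]
    ring

/-- `der_l y = sigD_{e_l} y`. [folklore] -/
theorem IsRootTower.der_apply (h : IsRootTower L K (p ^ e) x a) (he : 1 ≤ e) (l : Fin s) (y : K) :
    h.der he l y = h.sigD (Finsupp.single l 1) y := rfl

/-- `der_l(a_j) = −δ_{lj}`. [folklore] -/
theorem IsRootTower.der_gen (h : IsRootTower L K (p ^ e) x a) (he : 1 ≤ e) (l j : Fin s) :
    h.der he l (a j) = if j = l then -1 else 0 := by
  rw [h.der_apply, h.sigD_single_gen he]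

omit [CharP K p] in
/-- A derivation of `K/L` vanishing on the generators `a_j`, `j ∈ Y`, vanishes on `L(a_j : j ∈ Y)`. [folklore] -/
theorem derivation_eq_zero_of_mem_adjoin (h : IsRootTower L K (p ^ e) x a) (D : Derivation L K K) (Y : Set (Fin s))
    (hD : ∀ j ∈ Y, D (a j) = 0) {y : K} (hy : y ∈ IntermediateField.adjoin L (a '' Y)) : D y = 0 := by
  haveI := h.finiteDimensional
  have halg : ∀ z ∈ a '' Y, IsAlgebraic L z := fun z _ => Algebra.IsAlgebraic.isAlgebraic z
  have hy' : y ∈ Algebra.adjoin L (a '' Y) := by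
    rw [← IntermediateField.adjoin_toSubalgebra_of_isAlgebraic halg]
    exact hy
  have hEq : Set.EqOn D (0 : Derivation L K K) (a '' Y) := by
    rintro _ ⟨j, hj, rfl⟩
    rw [hD j hj]
    rfl
  have := Derivation.eqOn_adjoin hEq hy'
  rw [this]
  rfl

/-! ### `Θ_1(v) = span {v, sigD_{e_l} v}` and its dimension -/

omit hp in
/-- A multi-index of degree `≤ 1` is `0` or a unit vector. [folklore] -/
theorem eq_zero_or_exists_single_of_degree_le_one {T : Fin s →₀ ℕ} (hT : T.degree ≤ 1) :
    T = 0 ∨ ∃ l, T = Finsupp.single l 1 := by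
  classical
  by_cases h0 : T = 0
  · exact Or.inl h0
  · right
    obtain ⟨l, hl⟩ : ∃ l, T l ≠ 0 := by
      by_contra hall
      push Not at hall
      exact h0 (Finsupp.ext hall)
    refine ⟨l, Finsupp.ext fun i => ?_⟩
    rw [Finsupp.degree_eq_sum] at hT
    have hle : T l + (if i = l then 0 else T i) ≤ ∑ j, T j := by
      by_cases hil : i = l
      · rw [if_pos hil, add_zero]
        exact Finset.single_le_sum (f := fun j => T j) (fun _ _ => Nat.zero_le _) (Finset.mem_univ l)
      · rw [if_neg hil]
        have := Finset.add_le_sum (f := fun j => T j) (fun _ _ => Nat.zero_le _) (Finset.mem_univ l) (Finset.mem_univ i)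
          (Ne.symm hil)
        exact this
    by_cases hil : i = l
    · subst hil
      rw [Finsupp.single_eq_same]
      omega
    · rw [Finsupp.single_eq_of_ne hil]
      rw [if_neg hil] at hle
      omega

variable {ι : Type*} [Fintype ι]

omit [Fintype ι] in
/-- **`Θ_1(v) = span_K {v, (sigD_{e_l} v_i)_i : l}`.** [cite: Mizutani1973HironakaGroupSchemes, proof of Thm. 2.8 (Diff_1(k) = k ⊕ Der(k/k^p))] -/
theorem IsRootTower.thetaSpan_one_eq (h : IsRootTower L K (p ^ e) x a) (v : ι → K) :
    h.thetaSpan 1 v = Submodule.span K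
      (insert v (Set.range fun l : Fin s => fun i => h.sigD (Finsupp.single l 1) (v i))) := by
  classical
  unfold IsRootTower.thetaSpan
  apply le_antisymm
  · rw [Submodule.span_le]
    rintro _ ⟨T, hT, rfl⟩
    have hT' : T.degree ≤ 1 := mem_degLE.mp (Finset.mem_coe.mp hT)
    rcases eq_zero_or_exists_single_of_degree_le_one hT' with rfl | ⟨l, rfl⟩
    · have : (fun i => h.sigD 0 (v i)) = v := by funext i; rw [h.sigD_zero, LinearMap.id_apply]
      change (fun i => h.sigD 0 (v i)) ∈ _
      rw [this]
      exact Submodule.subset_span (Set.mem_insert _ _)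
    · change (fun i => h.sigD (Finsupp.single l 1) (v i)) ∈ _
      exact Submodule.subset_span (Set.mem_insert_of_mem _ ⟨l, rfl⟩)
  · rw [Submodule.span_le]
    intro g hg
    rcases (Set.mem_insert_iff.mp hg) with rfl | ⟨l, rfl⟩
    · have : (fun i => h.sigD 0 (g i)) = g := by funext i; rw [h.sigD_zero, LinearMap.id_apply]
      refine Submodule.subset_span ⟨0, Finset.mem_coe.mpr (mem_degLE.mpr (by simp)), this⟩
    · exact Submodule.subset_span ⟨Finsupp.single l 1, Finset.mem_coe.mpr (mem_degLE.mpr (by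
        rw [Finsupp.degree_single])), rfl⟩

omit [Fintype ι] in
/-- **`dim_K Θ_1(v) = #Y + 1` for an adapted `p`-basis** (Mizutani: «`dim_k Diff_1(k)·f = r + 1` if `[k^p(c(f)) : k^p] = p^r`»):
if `v_{i₀} = 1` and the subfield generated by the `v_i` is `L(a_j : j ∈ Y)` for a set `Y` of generators of the tower, then
`Θ_1(v)` has dimension `#Y + 1` — the derivations `sigD_{e_l}`, `l ∉ Y`, kill `v`, and `v`, `(sigD_{e_l} v)_{l ∈ Y}` are independent.
[cite: Mizutani1973HironakaGroupSchemes, proof of Thm. 2.8, Step (I) (p. 91)] -/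
theorem IsRootTower.finrank_thetaSpan_one (h : IsRootTower L K (p ^ e) x a) (he : 1 ≤ e) (v : ι → K) {i₀ : ι}
    (hv0 : v i₀ = 1) (Y : Finset (Fin s))
    (hadapt : IntermediateField.adjoin L (Set.range v) = IntermediateField.adjoin L (a '' (Y : Set (Fin s)))) :
    Module.finrank K (h.thetaSpan 1 v) = Y.card + 1 := by
  classical
  -- the derivation vectors
  set Dv : Fin s → ι → K := fun l i => h.sigD (Finsupp.single l 1) (v i) with hDv
  -- (1) `l ∉ Y`: `Dv l = 0`
  have hkill : ∀ l, l ∉ Y → Dv l = 0 := by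
    intro l hl
    funext i
    have hvi : v i ∈ IntermediateField.adjoin L (a '' (Y : Set (Fin s))) := by
      rw [← hadapt]
      exact IntermediateField.subset_adjoin _ _ ⟨i, rfl⟩
    have := derivation_eq_zero_of_mem_adjoin h (h.der he l) Y (fun j hj => by
      rw [h.der_gen, if_neg]
      rintro rfl
      exact hl hj) hvi
    rw [h.der_apply] at this
    rw [hDv]
    exact this
  -- (2) the family `v, (Dv l)_{l ∈ Y}` indexed by `Option Y`
  set fam : Option Y → ι → K := fun o => Option.elim o v fun l => Dv l with hfam
  have hspan : h.thetaSpan 1 v = Submodule.span K (Set.range fam) := by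
    rw [h.thetaSpan_one_eq]
    apply le_antisymm
    · rw [Submodule.span_le]
      intro g hg
      rcases (Set.mem_insert_iff.mp hg) with rfl | ⟨l, rfl⟩
      · exact Submodule.subset_span ⟨none, rfl⟩
      · change (fun i => h.sigD (Finsupp.single l 1) (v i)) ∈ _
        by_cases hl : l ∈ Y
        · exact Submodule.subset_span ⟨some ⟨l, hl⟩, rfl⟩
        · have : (fun i => h.sigD (Finsupp.single l 1) (v i)) = 0 := hkill l hl
          rw [this]
          exact Submodule.zero_mem _
    · rw [Submodule.span_le]
      rintro _ ⟨o, rfl⟩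
      rcases o with _ | ⟨l, hl⟩
      · exact Submodule.subset_span (Set.mem_insert _ _)
      · exact Submodule.subset_span (Set.mem_insert_of_mem _ ⟨l, rfl⟩)
  -- (3) linear independence of `fam`
  have hli : LinearIndependent K fam := by
    rw [Fintype.linearIndependent_iff]
    intro μ hμ
    -- coordinate `i₀`: `μ none = 0`
    have h0 : μ none = 0 := by
      have := congrFun hμ i₀
      rw [Finset.sum_apply, Pi.zero_apply, Fintype.sum_option] at this
      simp only [hfam, Option.elim, Pi.smul_apply, smul_eq_mul, hv0, mul_one] at this
      have hzero : ∀ l : Y, μ (some l) * Dv l i₀ = 0 := fun l => by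
        rw [hDv]
        simp only
        rw [hv0, h.sigD_one (Finsupp.single_ne_zero.mpr one_ne_zero), mul_zero]
      rw [Finset.sum_eq_zero (fun l _ => hzero l), add_zero] at this
      exact this
    -- the derivation `Σ_{l ∈ Y} μ_l der_l` kills every `v_i`, hence `L(a_Y)`, hence each `a_j`, `j ∈ Y`
    set D : Derivation L K K := ∑ l : Y, μ (some l) • h.der he l with hD
    have hDapply : ∀ y, D y = ∑ l : Y, μ (some l) * h.sigD (Finsupp.single (l : Fin s) 1) y := by
      intro y
      have hcoe := map_sum (Derivation.coeFnAddMonoidHom (R := L) (A := K) (M := K))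
        (fun l : Y => μ (some l) • h.der he l) Finset.univ
      rw [Derivation.coeFnAddMonoidHom_apply] at hcoe
      have := congrFun hcoe y
      rw [hD, this, Finset.sum_apply]
      refine Finset.sum_congr rfl fun l _ => ?_
      rw [Derivation.coeFnAddMonoidHom_apply, Derivation.coe_smul, Pi.smul_apply, smul_eq_mul, h.der_apply]
    have hDv0 : ∀ i, D (v i) = 0 := by
      intro i
      have := congrFun hμ i
      rw [Finset.sum_apply, Pi.zero_apply, Fintype.sum_option, h0, zero_smul, Pi.zero_apply, zero_add] at this
      rw [hDapply]
      refine (Finset.sum_congr rfl fun l _ => ?_).trans this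
      rw [Pi.smul_apply, smul_eq_mul]
      rfl
    have hDgen : ∀ j ∈ (Y : Set (Fin s)), D (a j) = 0 := by
      intro j hj
      have hmem : a j ∈ IntermediateField.adjoin L (Set.range v) := by
        rw [hadapt]
        exact IntermediateField.subset_adjoin _ _ ⟨j, hj, rfl⟩
      -- `D` vanishes on `L(v)` since it vanishes on the generators `v_i`
      haveI := h.finiteDimensional
      have halg : ∀ z ∈ Set.range v, IsAlgebraic L z := fun z _ => Algebra.IsAlgebraic.isAlgebraic z
      have hmem' : a j ∈ Algebra.adjoin L (Set.range v) := by
        rw [← IntermediateField.adjoin_toSubalgebra_of_isAlgebraic halg]; exact hmem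
      have hEq : Set.EqOn D (0 : Derivation L K K) (Set.range v) := by
        rintro _ ⟨i, rfl⟩; rw [hDv0 i]; rfl
      have := Derivation.eqOn_adjoin hEq hmem'
      rw [this]; rfl
    intro o
    rcases o with _ | ⟨j, hj⟩
    · exact h0
    · have := hDgen j (Finset.mem_coe.mpr hj)
      rw [hDapply] at this
      simp only [h.sigD_single_gen he] at this
      rw [Finset.sum_eq_single (⟨j, hj⟩ : Y) (fun l _ hl => by
        rw [if_neg (fun hjl => hl (Subtype.ext hjl.symm)), mul_zero]) (fun hn => absurd (Finset.mem_univ _) hn)] at this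
      simpa using this
  rw [hspan, finrank_span_eq_card hli, Fintype.card_option, Fintype.card_coe]

/-! ### The upper bound `dim Θ_{q−1}(v) + d ≤ #ι` -/

/-- **`dim_K Θ_m(v) + d ≤ #ι`** when `d` `K`-linearly independent columns `W_l` pair with `v` into `J^q` (`m + 1 ≤ q`): `Θ_m(v)` lies in the
common kernel of the `d` independent functionals `g ↦ Σ_i g_i W_l i` (Mizutani: `θ_1(f)` consists of forms through the point, so
`dim θ_1(f) ≤ dim W − dim V`). [cite: Mizutani1973HironakaGroupSchemes, proof of Thm. 2.8 (θ_1(f) ⊂ 𝔭 ∩ L, codim θ_1(f))] -/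
theorem IsRootTower.finrank_thetaSpan_add_le_card (h : IsRootTower L K (p ^ e) x a) {m : ℕ} (hm : m + 1 ≤ p ^ e) (v : ι → K)
    {d : ℕ} (W : Fin d → ι → K) (hWind : LinearIndependent K W)
    (hW : ∀ l, pairTensor L (W l) v ∈ KaehlerDifferential.ideal L K ^ p ^ e) :
    Module.finrank K (h.thetaSpan m v) + d ≤ Fintype.card ι := by
  classical
  -- `W` as a `d × ι` matrix; `Φ = W.mulVecLin : g ↦ (Σ_i W_l i g_i)_l`
  let A : Matrix (Fin d) ι K := W
  have hA : ∀ g l, A.mulVecLin g l = ∑ i, g i * W l i := by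
    intro g l
    rw [Matrix.mulVecLin_apply, Matrix.mulVec, dotProduct]
    exact Finset.sum_congr rfl fun i _ => mul_comm _ _
  -- `Θ ≤ ker Φ`
  have hker : h.thetaSpan m v ≤ LinearMap.ker A.mulVecLin := by
    intro g hg
    rw [LinearMap.mem_ker]
    funext l
    rw [hA, Pi.zero_apply]
    exact h.thetaSpan_sum_mul_eq_zero hm v (W l) (hW l) hg
  -- `rank Φ = d` (the rows `W_l` are independent)
  have hrank : Module.finrank K (LinearMap.range A.mulVecLin) = d := by
    change A.rank = d
    rw [Matrix.rank_eq_finrank_span_row]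
    have hrow : Set.range A.row = Set.range W := rfl
    rw [hrow, finrank_span_eq_card hWind, Fintype.card_fin]
  have hrn := LinearMap.finrank_range_add_finrank_ker A.mulVecLin
  rw [hrank, Module.finrank_fintype_fun_eq_card] at hrn
  haveI := h.thetaSpan_finite m v
  have := Submodule.finrank_mono hker
  omega

end TowerDerivation

end Summit.ResolutionOfSingularities.KangarooAtlas.Mizutani

end
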